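import Mathlib.Analysis.Calculus.IteratedDeriv.Lemmas
import Mathlib.Analysis.Calculus.IteratedDeriv.FaaDiBruno
import Mathlib.Analysis.Calculus.FDeriv.Analytic
import Mathlib.Analysis.Calculus.Deriv.ZPow
import Mathlib.Analysis.Analytic.Constructions
import Mathlib.Analysis.Analytic.OfScalars
import Mathlib.Analysis.Complex.CauchyIntegral
import Mathlib.Analysis.Complex.TaylorSeries
import Mathlib.Analysis.SpecialFunctions.Complex.Analytic
import Literature.NumberTheory.LFunctions.XiTaylor
import Literature.NumberTheory.LFunctions.RiemannXiProofs
import Literature.NumberTheory.LFunctions.RHConditionalFacts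
import HarnessLib

/-!
# Li's criterion for the Riemann hypothesis — Li's 1997 proof, formalised up to two named facts

X.-J. Li, *The positivity of a sequence of numbers and the Riemann hypothesis*, J. Number Theory
**65** (1997), 325–333, Theorem 1: *the nontrivial zeros of `ζ` lie on the critical line if and
only if `λ_n ≥ 0` for every positive integer `n`*, where (Li's (1.1))
`(n−1)! λ_n = dⁿ/dsⁿ [s^{n−1} log ξ(s)]|_{s=1}` (tree: `Literature.NumberTheory.LFunctions.keiperLiCoeff`; the fact is
`Literature.NumberTheory.LFunctions.li_criterion` in `RHConditionalFacts.lean`).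

This file formalises Li's proof (pp. 326–328 of the paper) and reduces `li_criterion` to two named
facts already in the tree:

* `Literature.NumberTheory.LFunctions.keiperLiCoeff_eq_zero_sum` (Li 1997, (1.4): `λ_n = Σ_ρ [1 − (1 − 1/ρ)ⁿ]`, which Li
  obtains from the Hadamard product (1.3) of `ξ`; Bombieri–Lagarias 1999, Thm. 1) — used for the
  necessity half exactly as on p. 328: under RH `|1 − 1/ρ| = 1`, so every term has real part
  `1 − cos(nθ_ρ) ≥ 0` (`keiperLiCoeff_nonneg_of_zero_sum`);
* `Literature.NumberTheory.LFunctions.xiTaylorCoeff_pos` (positivity of the Taylor coefficients of `ξ` at `½`, i.e. of Li's `a_j`,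
  which Li derives from the integral representation (1.2)/(1.6)) — used for the sufficiency half.

Main results:

* `Literature.liMap z = 1/(1 − z)`, `Literature.liPhi = ξ ∘ liMap` (Li's `φ`, p. 325 (1.2)/(1.3)).
* `Literature.NumberTheory.LFunctions.iteratedDeriv_pow_mul_eq_iteratedDeriv_comp_liMap`: the change of variables behind
  (1.1) = (1.4)/(1.5): `dⁿ/dsⁿ[s^{n−1} G(s)]|_{s=1} = dⁿ/dzⁿ[G(1/(1−z))]|_{z=0}` for `G` analytic at
  `1` (a Lagrange–Bürmann identity, proved by induction via Leibniz' rule), whence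
  `keiperLiCoeff_eq_iteratedDeriv_log_liPhi : λ_n = Re(dⁿ/dzⁿ[log φ]|₀ /(n−1)!)`, i.e.
  `log φ(z) = log φ(0) + Σ λ_n zⁿ/n` (Li p. 326: `φ'/φ = Σ λ_{n+1} zⁿ`).
* `Literature.NumberTheory.LFunctions.li_lemma_ne_zero`: Li's sufficiency argument (pp. 327–328) in abstract form — if `f` is
  holomorphic on the unit disc, `f(0) ≠ 0`, all Taylor coefficients of `f` at `0` are `≥ 0`, and
  `Re dᵏ[log f](0) ≥ 0` for `k ≥ 1`, then `f ≠ 0` on the disc. (Li: `λ_n ≤ n a_n` by the recurrence,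
  so `Σ λ_n z^{n−1}` converges in the disc and `log φ` extends; here the recurrence is replaced by
  Faà di Bruno's formula for `f = exp ∘ log f`, Mathlib's
  `iteratedDeriv_comp_eq_sum_orderedFinpartition`, and the extension by the identity theorem.)
* `Literature.NumberTheory.LFunctions.iteratedDeriv_liPhi_zero_nonneg`: Li's `a_j ≥ 0` (Lemma on p. 327) from `xiTaylorCoeff_pos`
  (and Schwarz reflection `riemannXi_conj_holds`), via Taylor expansion of `ξ` about `½` and Faà di
  Bruno for `ξ ∘ liMap` (`dᵏ liMap(0) = k!`).
* `Literature.NumberTheory.LFunctions.riemannHypothesis_of_liPhi_ne_zero`: `φ ≠ 0` on `|z| < 1` ⟹ RH (p. 326: `|1 − 1/ρ| < 1 ⟺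
  Re ρ > ½`, the functional equation, and "nontrivial zeros of `ζ` are zeros of `ξ`").
* `Literature.NumberTheory.LFunctions.li_criterion_of` : `keiperLiCoeff_eq_zero_sum → xiTaylorCoeff_pos → li_criterion`, and the
  two halves `riemannHypothesis_of_keiperLiCoeff_nonneg` (needs only `xiTaylorCoeff_pos`) and
  `keiperLiCoeff_nonneg_of_zero_sum`.

`theorem li_criterion_holds : li_criterion` will follow by `li_criterion_of F1_holds F2_holds` once
the two facts are discharged (Hadamard factorisation of `ξ`; the cosine-integral representation of
`Ξ`), neither of which is in Mathlib (v4.32).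

Small general lemmas placed in Mathlib namespaces as deliberate dot-notation extensions:
`OrderedFinpartition.single`, `.sum_partSize`, `.partSize_eq_of_length_eq_one`,
`.partSize_lt_of_length_ne_one`.

## References

* X.-J. Li, *The positivity of a sequence of numbers and the Riemann hypothesis*, J. Number Theory
  65 (1997), 325–333, Thm. 1 and its proof, eqs. (1.1)–(1.5). doi:10.1006/jnth.1997.2137
* E. Bombieri, J. C. Lagarias, *Complements to Li's criterion for the Riemann hypothesis*,
  J. Number Theory 77 (1999), 274–287, Thm. 1.
* E. C. Titchmarsh, *The Theory of the Riemann Zeta-Function*, 2nd ed. (1986), §2.1, §2.12.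
-/

noncomputable section

open Complex Filter Topology Set
open scoped Nat ComplexOrder NNReal ENNReal

/-! ## Ordered finpartitions: the one-block partition and part sizes -/

namespace OrderedFinpartition

/-- The ordered finpartition of `Fin k` (`k ≥ 1`) with a single part (dot-notation extension of
Mathlib's `OrderedFinpartition`, the index type of Faà di Bruno's formula). [folklore] -/
def single (k : ℕ) (hk : 0 < k) : OrderedFinpartition k where
  length := 1
  partSize _ := k
  partSize_pos _ := hk
  emb _ := id
  emb_strictMono _ := strictMono_id
  parts_strictMono := Subsingleton.strictMono _
  disjoint := (Set.subsingleton_of_subsingleton).pairwise _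
  cover x := ⟨0, x, rfl⟩

/-- The one-block partition has length `1`. [folklore] -/
@[simp] theorem single_length (k : ℕ) (hk : 0 < k) : (single k hk).length = 1 := rfl

variable {k : ℕ} (c : OrderedFinpartition k)

/-- The part sizes of an ordered finpartition of `Fin k` add up to `k`. [folklore] -/
theorem sum_partSize : ∑ j, c.partSize j = k := by
  simpa using c.sum_sigma_eq_sum (fun _ ↦ (1 : ℕ))

/-- A one-block partition of `Fin k` has block size `k`. [folklore] -/
theorem partSize_eq_of_length_eq_one (h : c.length = 1) (j : Fin c.length) : c.partSize j = k := by
  have hsub : ∀ i i' : Fin c.length, i = i' := fun i i' ↦ Fin.ext (by omega)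
  calc c.partSize j = ∑ i, c.partSize i :=
        (Finset.sum_eq_single_of_mem j (Finset.mem_univ _) fun i _ hi ↦ absurd (hsub i j) hi).symm
    _ = k := c.sum_partSize

/-- In a partition of `Fin k` with at least two blocks every block has size `< k`. [folklore] -/
theorem partSize_lt_of_length_ne_one (h : c.length ≠ 1) (j : Fin c.length) : c.partSize j < k := by
  have hlen : 2 ≤ c.length := by
    have := j.isLt
    omega
  obtain ⟨j', hj'⟩ : ∃ j' : Fin c.length, j' ≠ j := by
    by_cases hj : (j : ℕ) = 0
    · exact ⟨⟨1, by omega⟩, fun h' ↦ by simp [Fin.ext_iff, hj] at h'⟩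
    · exact ⟨⟨0, by omega⟩, fun h' ↦ hj (by simp [Fin.ext_iff] at h'; omega)⟩
  have hle : c.partSize j + c.partSize j' ≤ k := by
    rw [← Finset.sum_pair hj'.symm]
    exact (Finset.sum_le_sum_of_subset (Finset.subset_univ _)).trans_eq c.sum_partSize
  have := c.partSize_pos j'
  omega

end OrderedFinpartition

namespace Literature.NumberTheory.LFunctions

/-! ## The order on `ℂ` (`open scoped ComplexOrder`: `0 ≤ z ↔ 0 ≤ Re z ∧ Im z = 0`) -/

/-- For `0 ≤ a` in `ℂ` (i.e. `a` real and non-negative), `‖a‖ = Re a`. [folklore] -/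
theorem norm_eq_re_of_complex_nonneg {a : ℂ} (ha : 0 ≤ a) : ‖a‖ = a.re := by
  obtain ⟨hr, hi⟩ := Complex.nonneg_iff.1 ha
  have : a = (a.re : ℂ) := Complex.ext rfl hi.symm
  rw [this, Complex.norm_real, Real.norm_eq_abs, abs_of_nonneg hr, Complex.ofReal_re]

/-- The norm is monotone on the non-negative cone of `ℂ`. [folklore] -/
theorem norm_le_norm_of_complex_nonneg_of_le {a b : ℂ} (ha : 0 ≤ a) (hab : a ≤ b) :
    ‖a‖ ≤ ‖b‖ := by
  rw [norm_eq_re_of_complex_nonneg ha, norm_eq_re_of_complex_nonneg (ha.trans hab)]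
  exact (Complex.le_def.1 hab).1

/-- `dⁿ(dʲ f) = dⁿ⁺ʲ f`. [folklore] -/
theorem iteratedDeriv_iteratedDeriv {𝕜 F : Type*} [NontriviallyNormedField 𝕜]
    [NormedAddCommGroup F] [NormedSpace 𝕜 F] (f : 𝕜 → F) (n j : ℕ) :
    iteratedDeriv n (iteratedDeriv j f) = iteratedDeriv (n + j) f := by
  simp only [iteratedDeriv_eq_iterate, Function.iterate_add]
  rfl

/-! ## Li's map `z ↦ 1/(1 − z)` and `φ = ξ ∘ liMap` -/

/-- Li's Möbius map `m(z) = 1/(1 − z)` (Li 1997, (1.2)–(1.3): `φ(z) = ξ(1/(1−z))`); it maps the unit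
disc onto the half-plane `Re s > ½` and `0 ↦ 1`. [cite: Li1997, eq. (1.3)] -/
def liMap (z : ℂ) : ℂ := (1 - z)⁻¹

/-- `m(0) = 1`. [folklore] -/
@[simp] theorem liMap_zero : liMap 0 = 1 := by simp [liMap]

/-- `m'(z) = m(z)²` for `z ≠ 1`. [folklore] -/
theorem hasDerivAt_liMap {z : ℂ} (hz : z ≠ 1) : HasDerivAt liMap (liMap z ^ 2) z := by
  have h := ((hasDerivAt_id z).const_sub 1).inv (sub_ne_zero.2 hz.symm)
  refine h.congr_deriv ?_
  simp only [id, neg_neg, liMap, inv_pow, one_div]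

/-- `m` is analytic away from `1`. [folklore] -/
theorem analyticAt_liMap {z : ℂ} (hz : z ≠ 1) : AnalyticAt ℂ liMap z :=
  (analyticAt_const.sub analyticAt_id).inv (sub_ne_zero.2 hz.symm)

/-- `dᵏm/dzᵏ(0) = k!` (all Taylor coefficients of `1/(1−z)` are `1`). [folklore] -/
theorem iteratedDeriv_liMap_zero (k : ℕ) : iteratedDeriv k liMap 0 = k ! := by
  have : liMap = fun x : ℂ ↦ (-1 * x + 1)⁻¹ := by
    funext x; simp only [liMap, neg_one_mul, neg_add_eq_sub]
  rw [this, iteratedDeriv_eq_iterate, iter_deriv_inv_linear]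
  simp only [mul_zero, zero_add, one_zpow, mul_one]
  rw [mul_assoc, mul_comm (k ! : ℂ), ← mul_assoc, ← mul_pow]
  simp

/-- Li's function `φ(z) = ξ(1/(1 − z))` (Li 1997, (1.2)–(1.3); Li's `ξ` is `2 ·` Riemann's, an
immaterial normalisation). [cite: Li1997, eq. (1.3)] -/
def liPhi : ℂ → ℂ := riemannXi ∘ liMap

/-- `φ(0) = ξ(1) = ½`. [folklore] -/
theorem liPhi_zero : liPhi 0 = 1 / 2 := by simp [liPhi, riemannXi_one]

/-- `φ` is holomorphic on the unit disc (indeed on `ℂ ∖ {1}`). [cite: Li1997, p. 330] -/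
theorem differentiableOn_liPhi : DifferentiableOn ℂ liPhi (Metric.ball 0 1) := by
  intro z hz
  have hz1 : z ≠ 1 := by
    rintro rfl
    simp at hz
  exact ((differentiable_riemannXi _).comp z
    (analyticAt_liMap hz1).differentiableAt).differentiableWithinAt

/-! ## Li's identity `(1.1) = (1.5)`: `λ_n` as Taylor coefficients of `log φ` -/

/-- Combinatorial identity behind the Leibniz step: `C(n+1,i)·n^{(i)} = C(n,i)·(n+1)^{(i)}` for
`i ≤ n` (falling factorials). [folklore] -/
theorem succ_choose_mul_descFactorial (n i : ℕ) (hi : i ≤ n) :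
    (n + 1).choose i * n.descFactorial i = n.choose i * (n + 1).descFactorial i := by
  have h1 := Nat.choose_mul_succ_eq n i
  have h2 : (n + 1) * n.descFactorial i = (n + 1 - i) * (n + 1).descFactorial i := by
    rw [← Nat.succ_descFactorial_succ, Nat.descFactorial_succ]
  have hpos : 0 < (n + 1) * (n + 1 - i) := Nat.mul_pos (Nat.succ_pos n) (by omega)
  apply Nat.eq_of_mul_eq_mul_left hpos
  calc (n + 1) * (n + 1 - i) * ((n + 1).choose i * n.descFactorial i)
      = ((n + 1).choose i * (n + 1 - i)) * ((n + 1) * n.descFactorial i) := by ring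
    _ = (n.choose i * (n + 1)) * ((n + 1 - i) * (n + 1).descFactorial i) := by rw [← h1, h2]
    _ = (n + 1) * (n + 1 - i) * (n.choose i * (n + 1).descFactorial i) := by ring

/-- Leibniz step: `d^{n+1}/ds^{n+1}[sⁿ G(s)]|_{s=1} = dⁿ/dsⁿ[s^{n+1} G'(s)]|_{s=1}` for `G` analytic
at `1` (both sides equal `Σ_i C(n,i) (n+1)^{(i)} G^{(n+1−i)}(1)`). [folklore] -/
theorem iteratedDeriv_pow_mul_one_succ {G : ℂ → ℂ} (hG : AnalyticAt ℂ G 1) (n : ℕ) :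
    iteratedDeriv (n + 1) (fun s ↦ s ^ n * G s) 1 =
      iteratedDeriv n (fun s ↦ s ^ (n + 1) * deriv G s) 1 := by
  have hp : ∀ m k : ℕ, ContDiffAt ℂ k (fun s : ℂ ↦ s ^ m) 1 := fun m k ↦
    (contDiff_id.pow m).contDiffAt
  rw [iteratedDeriv_fun_mul (hp n (n + 1)) hG.contDiffAt,
    iteratedDeriv_fun_mul (hp (n + 1) n) hG.deriv.contDiffAt]
  simp only [iteratedDeriv_pow, one_pow, mul_one, ← iteratedDeriv_succ']
  rw [Finset.sum_range_succ, Nat.descFactorial_eq_zero_iff_lt.2 (Nat.lt_succ_self n)]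
  simp only [Nat.cast_zero, mul_zero, zero_mul, add_zero]
  refine Finset.sum_congr rfl fun i hi ↦ ?_
  have hi' : i ≤ n := Nat.lt_succ_iff.1 (Finset.mem_range.1 hi)
  have hcast := congrArg (Nat.cast : ℕ → ℂ) (succ_choose_mul_descFactorial n i hi')
  push_cast at hcast
  rw [show n + 1 - i = n - i + 1 by omega, ← hcast]

/-- **Li's change of variables** (the calculus identity equating Li 1997 (1.1) with the Taylor
coefficients in (1.4)–(1.5); a case of Lagrange–Bürmann inversion for `s = 1/(1−z)`): for `G`
analytic at `1`, `dⁿ/dsⁿ[s^{n−1} G(s)]|_{s=1} = dⁿ/dzⁿ[G(1/(1−z))]|_{z=0}`. Proof by induction on `n`: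
`d/dz [G ∘ m] = (s² G') ∘ m` near `0` and the Leibniz step `iteratedDeriv_pow_mul_one_succ`. [cite: Li1997, eqs. (1.1), (1.4)–(1.5)] -/
theorem iteratedDeriv_pow_mul_eq_iteratedDeriv_comp_liMap (n : ℕ) :
    ∀ {G : ℂ → ℂ}, AnalyticAt ℂ G 1 →
      iteratedDeriv n (fun s ↦ s ^ (n - 1) * G s) 1 = iteratedDeriv n (G ∘ liMap) 0 := by
  induction n with
  | zero => intro G _; simp
  | succ n ih =>
    intro G hG
    have hG2 : AnalyticAt ℂ (fun s ↦ s ^ 2 * deriv G s) 1 := (analyticAt_id.pow 2).mul hG.deriv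
    have hev : deriv (G ∘ liMap) =ᶠ[𝓝 0] ((fun s ↦ s ^ 2 * deriv G s) ∘ liMap) := by
      have h1 : ∀ᶠ z in 𝓝 (0 : ℂ), AnalyticAt ℂ G (liMap z) := by
        have hc : ContinuousAt liMap 0 := (analyticAt_liMap zero_ne_one).continuousAt
        have := hG.eventually_analyticAt
        rw [← liMap_zero] at this
        exact hc.eventually this
      filter_upwards [h1, eventually_ne_nhds (zero_ne_one : (0 : ℂ) ≠ 1)] with z hz hz1
      have := (hz.differentiableAt.hasDerivAt.comp z (hasDerivAt_liMap hz1)).deriv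
      simpa [mul_comm] using this
    rw [show iteratedDeriv (n + 1) (G ∘ liMap) 0 = iteratedDeriv n (deriv (G ∘ liMap)) 0 by
      rw [iteratedDeriv_succ'], hev.iteratedDeriv_eq, ← ih hG2, Nat.add_sub_cancel]
    cases n with
    | zero => simp
    | succ k =>
      rw [iteratedDeriv_pow_mul_one_succ hG (k + 1)]
      congr 1
      funext s
      simp only [Nat.add_sub_cancel]
      ring

/-- `log ξ` (principal branch) is analytic at `s = 1`, since `ξ(1) = ½ > 0`. [folklore] -/
theorem analyticAt_log_riemannXi_one : AnalyticAt ℂ (fun s ↦ Complex.log (riemannXi s)) 1 := by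
  refine (differentiable_riemannXi.analyticAt 1).clog ?_
  rw [riemannXi_one, Complex.mem_slitPlane_iff]
  norm_num

/-- **Li's identity** (Li 1997, p. 326: "`λ_n` is also given by the expression (1.1)", i.e.
`φ'/φ(z) = Σ λ_{n+1} zⁿ`, `log φ(z) = log φ(0) + Σ_{n≥1} λ_n zⁿ/n`): for every `n`,
`λ_n = Re( dⁿ/dzⁿ[log φ]|_{z=0} / (n−1)! )` with the principal `log` (analytic near `0` as
`φ(0) = ½`). Li proves it through the zero sum (1.4); here it is the direct calculus identity
`iteratedDeriv_pow_mul_eq_iteratedDeriv_comp_liMap`. [cite: Li1997, p. 326] -/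
theorem keiperLiCoeff_eq_iteratedDeriv_log_liPhi (n : ℕ) :
    keiperLiCoeff n = (iteratedDeriv n (Complex.log ∘ liPhi) 0 / ((n - 1)! : ℂ)).re := by
  rw [keiperLiCoeff, iteratedDeriv_pow_mul_eq_iteratedDeriv_comp_liMap n
    analyticAt_log_riemannXi_one]
  rfl

/-! ## Li's power-series lemma (sufficiency half of the proof of Thm 1) -/

/-- **Li's lemma** (X.-J. Li, J. Number Theory 65 (1997), proof of Thm. 1, pp. 327–328, abstract
form). Let `f` be holomorphic on the unit disc with `f(0) ≠ 0`, all Taylor coefficients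
`f⁽ᵏ⁾(0)` non-negative reals, and `Re dᵏ/dzᵏ[log f]|₀ ≥ 0` for all `k ≥ 1`. Then `f` has no zero
in the unit disc. (Li: with `f = 1 + Σ a_j zʲ`, `a_j > 0`, and `f'/f = Σ λ_{n+1} zⁿ`, the recurrence
`λ_n = n a_n − Σ_{j<n} λ_j a_{n−j}` gives `0 ≤ λ_n ≤ n a_n`, so `Σ λ_n z^{n−1}` converges in the disc
and `f'/f` is analytic there. Here: Faà di Bruno for `f = exp ∘ log f` gives, by strong induction,
`0 ≤ d_k ≤ f⁽ᵏ⁾(0)/f(0)` for `d_k = dᵏ[log f](0)`, `k ≥ 1`; hence `Σ d_k zᵏ/k!` has radius `≥ 1`,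
its sum `ℓ` satisfies `exp ∘ ℓ = f` near `0`, so on the disc by the identity theorem.) [cite: Li1997, pp. 327–328] -/
theorem li_lemma_ne_zero {f : ℂ → ℂ} (hd : DifferentiableOn ℂ f (Metric.ball 0 1))
    (hpos : ∀ k, 0 ≤ iteratedDeriv k f 0) (h0 : f 0 ≠ 0)
    (hlam : ∀ k, 1 ≤ k → 0 ≤ (iteratedDeriv k (Complex.log ∘ f) 0).re) :
    ∀ z ∈ Metric.ball (0 : ℂ) 1, f z ≠ 0 := by
  -- notation
  set ℓ : ℂ → ℂ := Complex.log ∘ f with hℓ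
  set d : ℕ → ℂ := fun k ↦ iteratedDeriv k ℓ 0 with hd_def
  set e : ℕ → ℂ := fun k ↦ iteratedDeriv k f 0 with he_def
  have hf0 : 0 < f 0 := lt_of_le_of_ne (by simpa using hpos 0) (Ne.symm h0)
  have hf0re : 0 < (f 0).re := (Complex.pos_iff.1 hf0).1
  have hf0im : (f 0).im = 0 := (Complex.pos_iff.1 hf0).2.symm
  have hfan : AnalyticAt ℂ f 0 := hd.analyticAt (Metric.ball_mem_nhds 0 one_pos)
  have hℓan : AnalyticAt ℂ ℓ 0 := hfan.clog (Complex.mem_slitPlane_iff.2 (Or.inl hf0re))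
  have hfexp : f =ᶠ[𝓝 0] (Complex.exp ∘ ℓ) := by
    filter_upwards [hfan.continuousAt.eventually_ne h0] with z hz
    simp [hℓ, Complex.exp_log hz]
  -- Faà di Bruno for `f = exp ∘ ℓ`
  have hFdB : ∀ k, e k = ∑ c : OrderedFinpartition k, f 0 * ∏ j, d (c.partSize j) := by
    intro k
    simp only [he_def]
    rw [hfexp.iteratedDeriv_eq, iteratedDeriv_comp_eq_sum_orderedFinpartition
      (Complex.contDiff_exp.contDiffAt) hℓan.contDiffAt (le_refl (k : WithTop ℕ∞))]
    refine Finset.sum_congr rfl fun c _ ↦ ?_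
    rw [iteratedDeriv_eq_iterate, Complex.iter_deriv_exp]
    simp [hℓ, Complex.exp_log h0, hd_def]
  -- strong induction: `0 ≤ d k` and `f 0 * d k ≤ e k` for `k ≥ 1`
  have hind : ∀ k, 1 ≤ k → 0 ≤ d k ∧ f 0 * d k ≤ e k := by
    intro k
    induction k using Nat.strong_induction_on with
    | _ k ih =>
      intro hk
      classical
      let P : OrderedFinpartition k → Prop := fun c ↦ c.length = 1
      set S := ∑ c ∈ Finset.univ.filter (fun c ↦ ¬ P c), f 0 * ∏ j, d (c.partSize j) with hS_def
      set N := (Finset.univ.filter P).card with hN_def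
      have hS : 0 ≤ S := by
        refine Finset.sum_nonneg fun c hc ↦ mul_nonneg hf0.le (Finset.prod_nonneg fun j _ ↦ ?_)
        have hc' : c.length ≠ 1 := (Finset.mem_filter.1 hc).2
        exact (ih _ (c.partSize_lt_of_length_ne_one hc' j) (c.partSize_pos j)).1
      have hN : 1 ≤ N := by
        refine Finset.card_pos.2 ⟨OrderedFinpartition.single k hk, ?_⟩
        simp [P]
      have heq : e k = N • (f 0 * d k) + S := by
        rw [hFdB k, ← Finset.sum_filter_add_sum_filter_not Finset.univ P, hS_def, hN_def,
          ← Finset.sum_const]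
        congr 1
        refine Finset.sum_congr rfl fun c hc ↦ ?_
        have hc' : c.length = 1 := (Finset.mem_filter.1 hc).2
        congr 1
        have hsub : ∀ i i' : Fin c.length, i = i' := fun i i' ↦ Fin.ext (by omega)
        obtain ⟨j⟩ : Nonempty (Fin c.length) := ⟨⟨0, by omega⟩⟩
        rw [Finset.prod_eq_single_of_mem j (Finset.mem_univ _) fun i _ hi ↦ absurd (hsub i j) hi,
          c.partSize_eq_of_length_eq_one hc']
      have hek : 0 ≤ e k := hpos k
      -- imaginary parts: `d k` is real
      have him : (d k).im = 0 := by
        have h1 := congrArg Complex.im heq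
        rw [Complex.add_im, (Complex.nonneg_iff.1 hS).2.symm, (Complex.nonneg_iff.1 hek).2.symm,
          add_zero, nsmul_eq_mul, Complex.mul_im, Complex.natCast_re, Complex.natCast_im, zero_mul,
          add_zero, Complex.mul_im, hf0im, zero_mul, add_zero] at h1
        have : (N : ℝ) * (f 0).re ≠ 0 :=
          mul_ne_zero (by exact_mod_cast (by omega : N ≠ 0)) hf0re.ne'
        have h2 : (N : ℝ) * (f 0).re * (d k).im = 0 := by rw [mul_assoc]; exact h1.symm
        exact (mul_eq_zero.1 h2).resolve_left this
      have hdk : 0 ≤ d k := Complex.nonneg_iff.2 ⟨hlam k hk, him.symm⟩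
      refine ⟨hdk, ?_⟩
      have hprod : 0 ≤ f 0 * d k := mul_nonneg hf0.le hdk
      calc f 0 * d k ≤ N • (f 0 * d k) := by
            obtain ⟨M, hM⟩ : ∃ M, N = M + 1 := ⟨N - 1, by omega⟩
            rw [hM, succ_nsmul]
            exact le_add_of_nonneg_left (nsmul_nonneg hprod M)
        _ ≤ N • (f 0 * d k) + S := le_add_of_nonneg_right hS
        _ = e k := heq.symm
  -- norm bounds `‖d k‖ ≤ ‖e k‖ / ‖f 0‖`
  have hnorm : ∀ k, 1 ≤ k → ‖d k‖ ≤ ‖e k‖ / ‖f 0‖ := by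
    intro k hk
    obtain ⟨hdk, hle⟩ := hind k hk
    have h1 := norm_le_norm_of_complex_nonneg_of_le (mul_nonneg hf0.le hdk) hle
    rw [norm_mul] at h1
    rw [le_div_iff₀ (norm_pos_iff.2 h0), mul_comm]
    exact h1
  -- summability of the Taylor series of `f` at `z = r ∈ [0, 1)`
  have hsum_e : ∀ r : ℝ, 0 ≤ r → r < 1 →
      Summable fun n ↦ (n ! : ℝ)⁻¹ * r ^ n * ‖e n‖ := by
    intro r hr0 hr1
    have hr : (r : ℂ) ∈ Metric.ball (0 : ℂ) 1 := by
      simpa [Metric.mem_ball, Complex.norm_real, abs_of_nonneg hr0] using hr1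
    have H := Complex.hasSum_re (hasSum_taylorSeries_on_ball hd hr)
    refine H.summable.congr fun n ↦ ?_
    simp only [sub_zero, smul_eq_mul, he_def]
    rw [norm_eq_re_of_complex_nonneg (hpos n), ← Complex.ofReal_pow, ← Complex.ofReal_natCast,
      ← Complex.ofReal_inv, Complex.re_ofReal_mul, Complex.re_ofReal_mul, mul_assoc]
  -- the power series `Σ (d k / k!) zᵏ` has radius `≥ 1`
  let p : FormalMultilinearSeries ℂ ℂ ℂ :=
    FormalMultilinearSeries.ofScalars ℂ fun n ↦ (n ! : ℂ)⁻¹ * d n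
  have hp_rad : 1 ≤ p.radius := by
    refine ENNReal.le_of_forall_nnreal_lt fun r hr ↦ ?_
    have hr1 : (r : ℝ) < 1 := by exact_mod_cast hr
    refine p.le_radius_of_summable ?_
    refine Summable.of_norm_bounded_eventually_nat
      ((hsum_e r r.coe_nonneg hr1).div_const ‖f 0‖) ?_
    filter_upwards [eventually_ge_atTop 1] with n hn
    rw [Real.norm_eq_abs, abs_of_nonneg (by positivity), FormalMultilinearSeries.ofScalars_norm,
      norm_mul, norm_inv, Complex.norm_natCast]
    have := hnorm n hn
    calc (n ! : ℝ)⁻¹ * ‖d n‖ * (r : ℝ) ^ n ≤ (n ! : ℝ)⁻¹ * (‖e n‖ / ‖f 0‖) * (r : ℝ) ^ n := by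
          gcongr
      _ = (n ! : ℝ)⁻¹ * (r : ℝ) ^ n * ‖e n‖ / ‖f 0‖ := by ring
  have hp_pos : 0 < p.radius := lt_of_lt_of_le zero_lt_one hp_rad
  have hps : HasFPowerSeriesOnBall p.sum p 0 p.radius := p.hasFPowerSeriesOnBall hp_pos
  have hball : Metric.ball (0 : ℂ) 1 ⊆ Metric.eball (0 : ℂ) p.radius := by
    rw [← Metric.eball_ofReal]
    exact Metric.eball_subset_eball (by simpa using hp_rad)
  have hℓt_diff : DifferentiableOn ℂ p.sum (Metric.ball 0 1) := hps.differentiableOn.mono hball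
  -- `p.sum = ℓ` near `0`
  have hℓt_eq : p.sum =ᶠ[𝓝 0] ℓ := by
    obtain ⟨ε, hε, hℓε⟩ := hℓan.exists_ball_analyticOnNhd
    have hmem : Metric.ball (0 : ℂ) (min ε 1) ∈ 𝓝 (0 : ℂ) := Metric.ball_mem_nhds 0 (by positivity)
    filter_upwards [hmem] with z hz
    have hzε : z ∈ Metric.ball (0 : ℂ) ε := Metric.ball_subset_ball (min_le_left _ _) hz
    have hz1 : z ∈ Metric.ball (0 : ℂ) 1 := Metric.ball_subset_ball (min_le_right _ _) hz
    have H1 := hasSum_taylorSeries_on_ball hℓε.differentiableOn hzε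
    have H2 := hps.hasSum (hball hz1)
    simp only [zero_add] at H2
    refine H2.unique (H1.congr_fun fun n ↦ ?_)
    simp only [p, FormalMultilinearSeries.ofScalars_apply_eq, sub_zero, smul_eq_mul, hd_def]
    ring
  -- identity theorem on the disc: `f = exp ∘ p.sum`
  have hEq : EqOn f (Complex.exp ∘ p.sum) (Metric.ball 0 1) := by
    refine (hd.analyticOnNhd Metric.isOpen_ball).eqOn_of_preconnected_of_eventuallyEq
      ((hℓt_diff.cexp).analyticOnNhd Metric.isOpen_ball) (convex_ball 0 1).isPreconnected
      (Metric.mem_ball_self one_pos) ?_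
    filter_upwards [hfexp, hℓt_eq] with z hz1 hz2
    simp [hz1, hz2]
  intro z hz
  rw [hEq hz]
  exact Complex.exp_ne_zero _

/-! ## Positivity of the Taylor coefficients of `φ` at `0` (Li's `a_j > 0`, p. 327) -/

/-- All derivatives of `ξ` at `½` are `≥ 0` (real), given `xiTaylorCoeff_pos`: the odd ones vanish
(`ξ(1−s) = ξ(s)`), the even ones are `(2n)! γ(n)/(8 n!) > 0` with `γ = xiTaylorCoeff` real
(Schwarz reflection, `riemannXi_conj_holds`). [cite: Li1997, p. 327] -/
theorem iteratedDeriv_riemannXi_half_nonneg (hp : xiTaylorCoeff_pos) (m : ℕ) :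
    0 ≤ iteratedDeriv m riemannXi (1 / 2) := by
  obtain ⟨n, rfl | rfl⟩ := Nat.even_or_odd' m
  · have him := im_iteratedDeriv_riemannXi_half riemannXi_conj_holds (2 * n)
    have hpos := hp n
    rw [xiTaylorCoeff] at hpos
    have hre : (8 * (n ! : ℂ) / ((2 * n)! : ℂ) * iteratedDeriv (2 * n) riemannXi (1 / 2)).re =
        (8 * n ! / (2 * n)! : ℝ) * (iteratedDeriv (2 * n) riemannXi (1 / 2)).re := by
      have : (8 * (n ! : ℂ) / ((2 * n)! : ℂ)) = ((8 * n ! / (2 * n)! : ℝ) : ℂ) := by push_cast; ring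
      rw [this, Complex.re_ofReal_mul]
    rw [hre, mul_pos_iff_of_pos_left (by positivity)] at hpos
    exact Complex.nonneg_iff.2 ⟨hpos.le, him.symm⟩
  · rw [iteratedDeriv_riemannXi_half_odd]

/-- All derivatives of `ξ` at `1` are `≥ 0`, given `xiTaylorCoeff_pos`: expand the entire function
`ξ⁽ʲ⁾` about `½`, `ξ⁽ʲ⁾(1) = Σ_i ξ⁽ʲ⁺ⁱ⁾(½) (½)ⁱ / i!`, a series of non-negative reals. [cite: Li1997, p. 327] -/
theorem iteratedDeriv_riemannXi_one_nonneg (hp : xiTaylorCoeff_pos) (j : ℕ) :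
    0 ≤ iteratedDeriv j riemannXi 1 := by
  have hdiff : Differentiable ℂ (iteratedDeriv j riemannXi) :=
    differentiable_riemannXi.contDiff.differentiable_iteratedDeriv' j
  have H := Complex.hasSum_taylorSeries_of_entire hdiff (1 / 2) 1
  refine H.nonneg fun n ↦ ?_
  rw [iteratedDeriv_iteratedDeriv, smul_eq_mul, smul_eq_mul, ← mul_assoc,
    show ((n ! : ℂ))⁻¹ * (1 - 1 / 2 : ℂ) ^ n = (((n ! : ℝ))⁻¹ * (1 / 2) ^ n : ℝ) by push_cast; ring]
  exact mul_nonneg (Complex.zero_le_real.2 (by positivity))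
    (iteratedDeriv_riemannXi_half_nonneg hp _)

/-- **Li's positivity lemma** (Li 1997, p. 327: the Taylor coefficients `a_j` of `φ` at `0` are
positive), in the form `φ⁽ᵏ⁾(0) ≥ 0` for all `k`, given `xiTaylorCoeff_pos`: Faà di Bruno for
`φ = ξ ∘ m` with `ξ⁽ⁱ⁾(1) ≥ 0` and `m⁽ⁱ⁾(0) = i! ≥ 0`. (Li derives `a_j > 0` from the integral
representation (1.6); positivity of the Taylor coefficients of `ξ` at `½` is the same input.) [cite: Li1997, p. 327] -/
theorem iteratedDeriv_liPhi_zero_nonneg (hp : xiTaylorCoeff_pos) (k : ℕ) :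
    0 ≤ iteratedDeriv k liPhi 0 := by
  rw [liPhi, iteratedDeriv_comp_eq_sum_orderedFinpartition
    differentiable_riemannXi.contDiff.contDiffAt (analyticAt_liMap zero_ne_one).contDiffAt
    (le_refl (k : WithTop ℕ∞))]
  refine Finset.sum_nonneg fun c _ ↦ mul_nonneg ?_ (Finset.prod_nonneg fun j _ ↦ ?_)
  · rw [liMap_zero]
    exact iteratedDeriv_riemannXi_one_nonneg hp _
  · rw [iteratedDeriv_liMap_zero]
    exact_mod_cast Nat.cast_nonneg _

/-! ## From no zeros of `φ` in the unit disc to RH (Li 1997, p. 326) -/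

/-- If `φ ≠ 0` on the unit disc then `ξ(s) ≠ 0` for `Re s > ½`: `s = m(z)` with `z = 1 − 1/s`,
`|z| < 1 ⟺ |s − 1| < |s| ⟺ Re s > ½` (Li 1997, p. 326). [cite: Li1997, p. 326] -/
theorem riemannXi_ne_zero_of_liPhi_ne_zero (h : ∀ z ∈ Metric.ball (0 : ℂ) 1, liPhi z ≠ 0)
    {s : ℂ} (hs : 1 / 2 < s.re) : riemannXi s ≠ 0 := by
  have hs0 : s ≠ 0 := fun h0 ↦ by rw [h0] at hs; norm_num at hs
  have hz : 1 - s⁻¹ ∈ Metric.ball (0 : ℂ) 1 := by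
    rw [Metric.mem_ball, dist_zero_right,
      show (1 : ℂ) - s⁻¹ = (s - 1) / s by field_simp, norm_div,
      div_lt_one (norm_pos_iff.2 hs0), ← sq_lt_sq₀ (norm_nonneg _) (norm_nonneg _),
      Complex.sq_norm, Complex.sq_norm, Complex.normSq_apply, Complex.normSq_apply]
    simp only [sub_re, one_re, sub_im, one_im, sub_zero]
    nlinarith
  have := h _ hz
  simpa [liPhi, liMap] using this

/-- If `φ ≠ 0` on the unit disc then every zero of `ξ` has real part `½` (functional equation
`ξ(1−s) = ξ(s)` for `Re s < ½`). [cite: Li1997, p. 326] -/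
theorem re_eq_half_of_riemannXi_eq_zero (h : ∀ z ∈ Metric.ball (0 : ℂ) 1, liPhi z ≠ 0)
    {s : ℂ} (hs : riemannXi s = 0) : s.re = 1 / 2 := by
  rcases lt_trichotomy s.re (1 / 2) with h1 | h1 | h1
  · exfalso
    refine riemannXi_ne_zero_of_liPhi_ne_zero h (s := 1 - s) ?_ (by rwa [riemannXi_one_sub])
    simp only [sub_re, one_re]
    linarith
  · exact h1
  · exact absurd hs (riemannXi_ne_zero_of_liPhi_ne_zero h h1)

/-- If `φ = ξ ∘ m` has no zero in the unit disc, the Riemann hypothesis holds (Li 1997, p. 326: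
"a necessary and sufficient condition for the nontrivial zeros … to lie on the critical line is that
`φ'/φ` is analytic in the unit disk"; the nontrivial zeros of `ζ` are zeros of `ξ`,
`riemannXi_eq_zero_of_nontrivial`). [cite: Li1997, p. 326] -/
theorem riemannHypothesis_of_liPhi_ne_zero (h : ∀ z ∈ Metric.ball (0 : ℂ) 1, liPhi z ≠ 0) :
    RiemannHypothesis := fun _s hzeta htriv hone ↦
  re_eq_half_of_riemannXi_eq_zero h (riemannXi_eq_zero_of_nontrivial hzeta htriv hone)

/-! ## The two halves of Li's criterion and the assembly -/

/-- **Li's criterion, sufficiency** (Li 1997, Thm. 1, "if" direction, pp. 326–328), conditional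
only on the named fact `xiTaylorCoeff_pos` (positivity of the Taylor coefficients of `ξ` at `½`):
if `λ_n ≥ 0` for all `n ≥ 1` then RH. Assembly of `keiperLiCoeff_eq_iteratedDeriv_log_liPhi`,
`iteratedDeriv_liPhi_zero_nonneg`, `li_lemma_ne_zero` and `riemannHypothesis_of_liPhi_ne_zero`. [cite: Li1997, Thm. 1] -/
theorem riemannHypothesis_of_keiperLiCoeff_nonneg (hp : xiTaylorCoeff_pos)
    (hlam : ∀ n : ℕ, 1 ≤ n → 0 ≤ keiperLiCoeff n) : RiemannHypothesis := by
  refine riemannHypothesis_of_liPhi_ne_zero (li_lemma_ne_zero differentiableOn_liPhi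
    (iteratedDeriv_liPhi_zero_nonneg hp) (by rw [liPhi_zero]; norm_num) fun k hk ↦ ?_)
  have h := hlam k hk
  rw [keiperLiCoeff_eq_iteratedDeriv_log_liPhi, Complex.div_natCast_re] at h
  exact (div_nonneg_iff.1 h).elim (fun h' ↦ h'.1) fun h' ↦ by
    exfalso
    have : (0 : ℝ) < ((k - 1)! : ℕ) := by exact_mod_cast Nat.factorial_pos _
    linarith [h'.2]

/-- Under RH, `|1 − 1/ρ| = 1` for a zero `ρ` on the critical line (Li 1997, p. 328). [cite: Li1997, p. 328] -/
theorem norm_one_sub_inv_eq_one {ρ : ℂ} (hρ : ρ.re = 1 / 2) : ‖1 - 1 / ρ‖ = 1 := by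
  have hρ0 : ρ ≠ 0 := fun h ↦ by rw [h] at hρ; norm_num at hρ
  have h1 : ‖ρ - 1‖ = ‖ρ‖ := by
    rw [← pow_left_inj₀ (norm_nonneg _) (norm_nonneg _) two_ne_zero, Complex.sq_norm,
      Complex.sq_norm, Complex.normSq_apply, Complex.normSq_apply]
    simp only [sub_re, one_re, sub_im, one_im, sub_zero, hρ]
    norm_num
  rw [show (1 : ℂ) - 1 / ρ = (ρ - 1) / ρ by field_simp, norm_div, h1,
    div_self (norm_ne_zero_iff.2 hρ0)]

/-- **Li's criterion, necessity** (Li 1997, Thm. 1, "only if" direction, p. 328), conditional on the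
named fact `keiperLiCoeff_eq_zero_sum` (Li's (1.4), `λ_n = Σ*_ρ m(ρ)[1 − (1 − 1/ρ)ⁿ]`): under RH each
`1 − 1/ρ = e^{iθ_ρ}`, so every term of every finite box sum has real part `m(ρ)(1 − cos nθ_ρ) ≥ 0`,
and `λ_n`, the limit of the real parts, is `≥ 0`. [cite: Li1997, Thm. 1] -/
theorem keiperLiCoeff_nonneg_of_zero_sum (hsum : LFunctions.keiperLiCoeff_eq_zero_sum)
    (hRH : RiemannHypothesis) (n : ℕ) (hn : 1 ≤ n) : 0 ≤ keiperLiCoeff n := by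
  have H := (Complex.continuous_re.tendsto _).comp (hsum n hn)
  simp only [Complex.ofReal_re] at H
  refine ge_of_tendsto' H fun T ↦ ?_
  simp only [Function.comp_apply]
  rw [finsum_mem_eq_finite_toFinset_sum _ (LFunctions.liZeroBox_finite T), Complex.re_sum]
  refine Finset.sum_nonneg fun ρ hρ ↦ ?_
  obtain ⟨hz, -, -, him0, -⟩ := (Set.Finite.mem_toFinset _).1 hρ
  have hρ1 : ρ ≠ 1 := fun h ↦ by simp [h] at him0
  have hρtriv : ¬∃ k : ℕ, ρ = -2 * (k + 1) := by
    rintro ⟨k, rfl⟩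
    simp at him0
  have hρre : ρ.re = 1 / 2 := hRH ρ hz hρtriv hρ1
  have hm : (0 : ℝ) ≤ riemannZetaZeroOrder ρ := by
    exact_mod_cast ((riemannZetaZeroOrder_pos_iff hρ1).2 hz).le
  rw [Complex.mul_re, Complex.intCast_re, Complex.intCast_im, zero_mul, sub_zero]
  refine mul_nonneg hm ?_
  rw [Complex.sub_re, Complex.one_re, sub_nonneg]
  calc ((1 - 1 / ρ) ^ n).re ≤ ‖(1 - 1 / ρ) ^ n‖ := Complex.re_le_norm _
    _ = 1 := by rw [norm_pow, norm_one_sub_inv_eq_one hρre, one_pow]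

end Literature.NumberTheory.LFunctions

namespace Literature.NumberTheory.LFunctions

/-- **rh.S26** Li's criterion `RH ↔ ∀ n ≥ 1, λ_n ≥ 0` (Li 1997, Thm. 1), reduced to the two named
facts `keiperLiCoeff_eq_zero_sum` (Li's (1.4), from the Hadamard product of `ξ`) and
`xiTaylorCoeff_pos` (positivity of the Taylor coefficients of `ξ` at `½`); the rest of Li's proof is
formalised in this file. `li_criterion_holds` follows once these two facts are discharged. [cite: Li1997, Thm. 1] -/
theorem li_criterion_of (hsum : keiperLiCoeff_eq_zero_sum) (hp : xiTaylorCoeff_pos) :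
    li_criterion :=
  ⟨fun hRH n hn ↦ keiperLiCoeff_nonneg_of_zero_sum hsum hRH n hn,
    riemannHypothesis_of_keiperLiCoeff_nonneg hp⟩

end Literature.NumberTheory.LFunctions
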